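import Mathlib
import Summits.Ventures.PercRepro2.WForm

/-!
# The W-form is closed under products (blind cell PercRepro2, mine-1 g13)
proofs/MINE1-W-BLOCKS.md, Theorem (W-TENSOR).

**Theorem `wIneq_prod`**: if `W₁` on `α` and `W₂` on `β` satisfy `WIneq` for relations `D₁`, `D₂`
(`D₂` symmetric), then the product weight `p ↦ W₁ p.1 · W₂ p.2` on `α × β` satisfies `WIneq` for the
product relation `D₁ p.1 q.1 ∧ D₂ p.2 q.2`. For status laws this is the wedge of two rooted graphs at
their common root (`2^{F₁ ⊔ F₂} ≃ 2^{F₁} × 2^{F₂}`, disjointness coordinatewise): the W-inequality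
is closed under wedging at the root. The proof is the exact identity

  `4·Q(g, h) = 2 ∑_{D₁ s₁ t₁} W₁ s₁ W₁ t₁ [Q₂(g(s₁,·), h(s₁,·)) + Q₂(g(t₁,·), h(t₁,·))]
               + 4 ∑_{D₂ s₂ t₂} W₂ s₂ W₂ t₂ · Q₁(g(·, s₂), h(·, t₂))`

(`inner_identity`, `key_identity`), whose inner part holds POINTWISE after symmetrising in
`(s₂, t₂)` — a `ring` identity in the eight values `g/h (s₁|t₁, s₂|t₂)` — and all sections of
monotone functions on a product are monotone, so both parts are nonnegative.
-/

namespace Summit.Ventures.PercRepro2.WForm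

section Prod

variable {R : Type*} [CommRing R]
variable {α β : Type*} [Fintype α] [Fintype β]
variable (D₁ : α → α → Prop) [DecidableRel D₁] (D₂ : β → β → Prop) [DecidableRel D₂]

/-- The product relation on `α × β`. -/
def prodRel (p q : α × β) : Prop := D₁ p.1 q.1 ∧ D₂ p.2 q.2

/-- The product relation is decidable. -/
instance : DecidableRel (prodRel D₁ D₂) := fun p q => by
  unfold prodRel; infer_instance

/-- The product weight. -/
def prodW (W₁ : α → R) (W₂ : β → R) (p : α × β) : R := W₁ p.1 * W₂ p.2

omit [Fintype α] [Fintype β] in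
/-- The coefficient of a product weight factorises. -/
lemma coef_prod (W₁ : α → R) (W₂ : β → R) (p q : α × β) :
    coef (prodRel D₁ D₂) (prodW W₁ W₂) p q = coef D₁ W₁ p.1 q.1 * coef D₂ W₂ p.2 q.2 := by
  unfold coef prodRel prodW
  by_cases h1 : D₁ p.1 q.1
  · by_cases h2 : D₂ p.2 q.2
    · rw [if_pos ⟨h1, h2⟩, if_pos h1, if_pos h2]; ring
    · rw [if_neg (fun h => h2 h.2), if_neg h2, mul_zero]
  · rw [if_neg (fun h => h1 h.1), if_neg h1, zero_mul]

variable {D₁ D₂}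

/-- Interchange of two kernel sums. -/
lemma S_S_comm (W₁ : α → R) (W₂ : β → R) (X : α → α → β → β → R) :
    S D₁ W₁ (fun s₁ t₁ => S D₂ W₂ (fun s₂ t₂ => X s₁ t₁ s₂ t₂)) =
      S D₂ W₂ (fun s₂ t₂ => S D₁ W₁ (fun s₁ t₁ => X s₁ t₁ s₂ t₂)) := by
  unfold S
  simp only [Finset.mul_sum]
  calc ∑ s₁, ∑ t₁, ∑ s₂, ∑ t₂, coef D₁ W₁ s₁ t₁ * (coef D₂ W₂ s₂ t₂ * X s₁ t₁ s₂ t₂)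
      = ∑ s₁, ∑ s₂, ∑ t₁, ∑ t₂, coef D₁ W₁ s₁ t₁ * (coef D₂ W₂ s₂ t₂ * X s₁ t₁ s₂ t₂) :=
        Finset.sum_congr rfl fun s₁ _ => Finset.sum_comm
    _ = ∑ s₂, ∑ s₁, ∑ t₁, ∑ t₂, coef D₁ W₁ s₁ t₁ * (coef D₂ W₂ s₂ t₂ * X s₁ t₁ s₂ t₂) :=
        Finset.sum_comm
    _ = ∑ s₂, ∑ s₁, ∑ t₂, ∑ t₁, coef D₁ W₁ s₁ t₁ * (coef D₂ W₂ s₂ t₂ * X s₁ t₁ s₂ t₂) :=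
        Finset.sum_congr rfl fun s₂ _ => Finset.sum_congr rfl fun s₁ _ => Finset.sum_comm
    _ = ∑ s₂, ∑ t₂, ∑ s₁, ∑ t₁, coef D₁ W₁ s₁ t₁ * (coef D₂ W₂ s₂ t₂ * X s₁ t₁ s₂ t₂) :=
        Finset.sum_congr rfl fun s₂ _ => Finset.sum_comm
    _ = ∑ s₂, ∑ t₂, ∑ s₁, ∑ t₁, coef D₂ W₂ s₂ t₂ * (coef D₁ W₁ s₁ t₁ * X s₁ t₁ s₂ t₂) :=
        Finset.sum_congr rfl fun s₂ _ => Finset.sum_congr rfl fun t₂ _ =>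
          Finset.sum_congr rfl fun s₁ _ => Finset.sum_congr rfl fun t₁ _ => by ring

/-- The W-form of a product weight is the nested kernel sum. -/
lemma Q_prod_eq (W₁ : α → R) (W₂ : β → R) (g h : α × β → R) :
    Q (prodRel D₁ D₂) (prodW W₁ W₂) g h =
      S D₁ W₁ (fun s₁ t₁ => S D₂ W₂ (fun s₂ t₂ =>
        (g (s₁, s₂) - g (t₁, t₂)) * (h (s₁, s₂) - h (t₁, t₂)))) := by
  unfold Q S
  simp only [Finset.mul_sum]
  rw [Fintype.sum_prod_type]
  refine Finset.sum_congr rfl fun s₁ _ => ?_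
  calc ∑ s₂, ∑ q : α × β, coef (prodRel D₁ D₂) (prodW W₁ W₂) (s₁, s₂) q *
          ((g (s₁, s₂) - g q) * (h (s₁, s₂) - h q))
      = ∑ s₂, ∑ t₁, ∑ t₂, coef (prodRel D₁ D₂) (prodW W₁ W₂) (s₁, s₂) (t₁, t₂) *
          ((g (s₁, s₂) - g (t₁, t₂)) * (h (s₁, s₂) - h (t₁, t₂))) :=
        Finset.sum_congr rfl fun s₂ _ => Fintype.sum_prod_type _
    _ = ∑ t₁, ∑ s₂, ∑ t₂, coef (prodRel D₁ D₂) (prodW W₁ W₂) (s₁, s₂) (t₁, t₂) *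
          ((g (s₁, s₂) - g (t₁, t₂)) * (h (s₁, s₂) - h (t₁, t₂))) := Finset.sum_comm
    _ = ∑ t₁, ∑ s₂, ∑ t₂, coef D₁ W₁ s₁ t₁ * (coef D₂ W₂ s₂ t₂ *
          ((g (s₁, s₂) - g (t₁, t₂)) * (h (s₁, s₂) - h (t₁, t₂)))) :=
        Finset.sum_congr rfl fun t₁ _ => Finset.sum_congr rfl fun s₂ _ =>
          Finset.sum_congr rfl fun t₂ _ => by rw [coef_prod]; ring

omit [Fintype α] in
/-- The inner identity for fixed `s₁, t₁` (pointwise after symmetrisation, hence `ring`). -/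
lemma inner_identity (hD₂ : ∀ s t, D₂ s t → D₂ t s) (W₂ : β → R) (g h : α × β → R) (s₁ t₁ : α) :
    4 * S D₂ W₂ (fun s₂ t₂ => (g (s₁, s₂) - g (t₁, t₂)) * (h (s₁, s₂) - h (t₁, t₂))) =
      2 * (Q D₂ W₂ (fun s₂ => g (s₁, s₂)) (fun s₂ => h (s₁, s₂)) +
          Q D₂ W₂ (fun s₂ => g (t₁, s₂)) (fun s₂ => h (t₁, s₂))) +
        4 * S D₂ W₂ (fun s₂ t₂ => (g (s₁, s₂) - g (t₁, s₂)) * (h (s₁, t₂) - h (t₁, t₂))) := by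
  have e := two_S_eq_of_symm hD₂ W₂
    (fun s₂ t₂ => 2 * ((g (s₁, s₂) - g (t₁, t₂)) * (h (s₁, s₂) - h (t₁, t₂))))
    (fun s₂ t₂ => ((g (s₁, s₂) - g (s₁, t₂)) * (h (s₁, s₂) - h (s₁, t₂)) +
        (g (t₁, s₂) - g (t₁, t₂)) * (h (t₁, s₂) - h (t₁, t₂))) +
        2 * ((g (s₁, s₂) - g (t₁, s₂)) * (h (s₁, t₂) - h (t₁, t₂))))
    (fun s₂ t₂ => by ring)
  rw [S_smul, S_add, S_add, S_smul] at e
  simp only [Q]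
  linear_combination e

/-- The key identity: `4·Q` on the product is twice the section part plus four times the cross part. -/
lemma key_identity (hD₂ : ∀ s t, D₂ s t → D₂ t s) (W₁ : α → R) (W₂ : β → R)
    (g h : α × β → R) :
    4 * Q (prodRel D₁ D₂) (prodW W₁ W₂) g h =
      2 * S D₁ W₁ (fun s₁ t₁ => Q D₂ W₂ (fun s₂ => g (s₁, s₂)) (fun s₂ => h (s₁, s₂)) +
          Q D₂ W₂ (fun s₂ => g (t₁, s₂)) (fun s₂ => h (t₁, s₂))) +
        4 * S D₂ W₂ (fun s₂ t₂ => Q D₁ W₁ (fun s₁ => g (s₁, s₂)) (fun s₁ => h (s₁, t₂))) := by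
  rw [Q_prod_eq]
  conv_lhs => rw [← S_smul]
  rw [S_congr D₁ W₁ (fun s₁ t₁ => inner_identity hD₂ W₂ g h s₁ t₁), S_add, S_smul, S_smul]
  congr 1
  rw [S_S_comm]
  simp only [Q]

end Prod

section Main

variable {R : Type*} [CommRing R] [LinearOrder R] [IsStrictOrderedRing R]
variable {α β : Type*} [Fintype α] [Fintype β] [Preorder α] [Preorder β]
variable {D₁ : α → α → Prop} [DecidableRel D₁] {D₂ : β → β → Prop} [DecidableRel D₂]

/-- **(W-TENSOR)**: the W-inequality is closed under products — the wedge of two rooted graphs at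
the root. -/
theorem wIneq_prod (hD₂ : ∀ s t, D₂ s t → D₂ t s) {W₁ : α → R} {W₂ : β → R}
    (h₁ : WIneq D₁ W₁) (h₂ : WIneq D₂ W₂) : WIneq (prodRel D₁ D₂) (prodW W₁ W₂) := by
  refine ⟨fun p => mul_nonneg (h₁.1 p.1) (h₂.1 p.2), ?_⟩
  intro g h hg hh
  have hA : 0 ≤ S D₁ W₁ (fun s₁ t₁ => Q D₂ W₂ (fun s₂ => g (s₁, s₂)) (fun s₂ => h (s₁, s₂)) +
      Q D₂ W₂ (fun s₂ => g (t₁, s₂)) (fun s₂ => h (t₁, s₂))) := by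
    refine S_nonneg D₁ h₁.1 fun s₁ t₁ => add_nonneg ?_ ?_
    · exact h₂.2 _ _ (fun a b hab => hg (Prod.mk_le_mk.mpr ⟨le_refl s₁, hab⟩))
        (fun a b hab => hh (Prod.mk_le_mk.mpr ⟨le_refl s₁, hab⟩))
    · exact h₂.2 _ _ (fun a b hab => hg (Prod.mk_le_mk.mpr ⟨le_refl t₁, hab⟩))
        (fun a b hab => hh (Prod.mk_le_mk.mpr ⟨le_refl t₁, hab⟩))
  have hB : 0 ≤ S D₂ W₂ (fun s₂ t₂ => Q D₁ W₁ (fun s₁ => g (s₁, s₂)) (fun s₁ => h (s₁, t₂))) := by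
    refine S_nonneg D₂ h₂.1 fun s₂ t₂ => ?_
    exact h₁.2 _ _ (fun a b hab => hg (Prod.mk_le_mk.mpr ⟨hab, le_refl s₂⟩))
      (fun a b hab => hh (Prod.mk_le_mk.mpr ⟨hab, le_refl t₂⟩))
  have h4 : 0 ≤ 4 * Q (prodRel D₁ D₂) (prodW W₁ W₂) g h := by
    rw [key_identity hD₂]
    exact add_nonneg (mul_nonneg (by norm_num) hA) (mul_nonneg (by norm_num) hB)
  exact (mul_nonneg_iff_of_pos_left (by norm_num : (0 : R) < 4)).mp h4

end Main

end Summit.Ventures.PercRepro2.WForm
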